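import Literature.AlgebraicGeometry.Frobenioids.ArchimedeanAngloidAnchorsN
import Literature.AlgebraicGeometry.Frobenioids.ArchimedeanPointBaseProp35
import Literature.AlgebraicGeometry.Frobenioids.ArchimedeanProp35iSaturationIff
import Literature.AlgebraicGeometry.Frobenioids.ArchimedeanProp35iCounterexampleStd
import HarnessLib

/-!
# Frobenioids II, Proposition 3.5 (iii) for the non-rigidified angloid `N`, AS TYPED: true over every base
# whose REAL objects carry Galois-saturated quotient data — complex-image bases, THE base of [IUTchI]
# Example 3.4 (i), and the RC-standard base `T → D₀` at which Proposition 3.5 (i) FAILS as typed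

Mochizuki, *The geometry of Frobenioids II: poly-Frobenioids*, Kyushu J. Math. **62** (2008) 401–460, §3,
Proposition 3.5 p. 34 (journal pp. 428–430): "In the notation and terminology of Example 3.3 … Suppose further
that `D` is of RC-iso-subanchor type. Then … (iii) `G` [`= N`, `R`] is of RC-iso-subanchor type"; proof of (iii),
p. 430: "Just as in the case of assertion (ii), we may apply assertion (i) to conclude that … it suffices to show
that any `C ∈ Ob(G[ℂ])` such that `C_D` is an anchor of `D[ℂ]` is itself an anchor of `G[ℂ]`"
[cite: MochizukiFrdII2008, Prop 3.5 (iii) p.34]; base of *Inter-universal Teichmüller theory I*, Example 3.4 (i),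
kurims text (May 2020) p. 80 («the one-morphism category determined by `Spec(K_v)`», `ArchFrd.ptBase`)
[cite: Mochizuki2012, Ex 3.4 (i) p.80].

PROOF-ONLY companion of `ArchimedeanPointBaseProp35.lean` (abc-iut cell, layer L1, node `FrdII:Prop3.5(iii)`,
seat abc-iut-w4-d027 gen 3; follow-up named by the second reader abc-iut-w5-d146: «a kernel NON-VACUITY of the
repaired hypothesis at ptBase would make the repaired (iii) hypothesis-free at the IUT archimedean base»).
abc-iut-L1-t9's typed instance `ArchFrd.Prop35iii_N π` is FALSE for a general base (gen 2's
`not_prop35iii_N_collapse`, `ArchimedeanProp35iiiCounterexample.lean` — base `D₀ → D₀` collapsing complex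
conjugation, NOT complexifiable); gen 2 proved the REPAIRED form `prop35iii_N_of_saturated` (every object of `D`
a mono-minimal quotient of an RC-subanchor by a GALOIS-SATURATED group, abc-iut-w4-d100's `GaloisSaturated`).
This file locates the typed statement's domain of validity more sharply:

* **`prop35iii_N_of_saturated_real`** — `Prop35iii_N π` holds as soon as every REAL object of `D` admits a
  Galois-saturated mono-minimal quotient presentation by an RC-subanchor (over complex objects every
  presentation supplied by «`D` of RC-iso-subanchor type» is saturated: `galoisSaturated_of_isComplex`);
* hence AS TYPED over every base functor with complex image (**`prop35iii_N_of_forall_isComplex`**) [and over every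
  FAITHFUL base functor, by abc-iut-w4-d100's `galoisSaturated_of_faithful` (`ArchimedeanProp35iArithmeticBases.lean`) —
  a one-line corollary to be appended once that module's olean is built];
* at THE one-morphism base `Spec ℂ` of [IUTchI] Ex. 3.4 (i): **`prop35iii_N_ptBase`** and, the base being of
  RC-iso-subanchor type (`ptBase_isOfRCIsoSubanchorType`), **`N.isOfRCIsoSubanchorType_ptBase`** — `N_v` IS of
  RC-iso-subanchor type, no hypothesis left (abc-iut-w5-d146's N2);
* at abc-iut-w5-d013's two-object base `T → D₀` (`ArchimedeanProp35iToyBase.lean`: `b ↦ Spec ℂ`, `a ↦ Spec ℝ`,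
  `Aut(b) = ⟨σ, τ⟩`, `σ ↦ 𝟙`, `τ ↦` conjugation), which is of RC-STANDARD type and at which Prop. 3.5 (i) FAILS
  AS TYPED for `C`, `A`, `N` (`P35iToy.not_prop35i_C`; `prop35i_N_iff_C`): the quotient arrow `b → a` is ALSO a
  mono-minimal categorical quotient by the FULL group `Aut(b) ∋ τ`, a saturated presentation
  (`T.isMonoMinimalQuotient_fHom_top`, `galoisSaturated_fHom_top`; the typed datum `G_D = {1, σ}` is not
  saturated, `not_galoisSaturated_fHom_GD`), so **`prop35iii_N_toD0`**, **`isOfRCIsoSubanchorType_N_toD0`** and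
  **`prop35iii_N_and_not_prop35i_N_toD0`**: at this RC-standard base the typed (iii) for `N` HOLDS while the
  typed (i) — the printed route to (iii) («we may apply assertion (i)») — FAILS. (Kernel record only: the typed
  (iii) for `N` is refuted at the non-complexifiable collapse base and holds at both RC-standard bases in the
  tree; that it FAILS at some base of RC-standard type is `ArchimedeanProp35iiiStdCounterexample.lean`.)
No definitions; nothing re-typed; nothing here bears on [IUTchIII] Cor. 3.12.
-/

namespace Literature.AlgebraicGeometry.Frobenioids

open CategoryTheory

noncomputable section

namespace ArchFrd

universe v u

/-! ### Proposition 3.5 (iii) for `N` AS TYPED: saturation is needed over real objects only -/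

section General

variable {D : Type u} [Category.{v} D] (π : D ⥤ D0)

/-- **[FrdII] Prop. 3.5 (iii) for the non-rigidified angloid `N`, AS TYPED (`ArchFrd.Prop35iii_N π`), over every
base functor `π : D → D₀` whose REAL objects admit a Galois-saturated mono-minimal quotient presentation by an
RC-subanchor** (over complex objects any presentation given by «`D` of RC-iso-subanchor type» is saturated,
`galoisSaturated_of_isComplex`); assembled from the repaired form `prop35iii_N_of_saturated`.
[cite: MochizukiFrdII2008, Prop 3.5 (iii) p.34] -/
theorem prop35iii_N_of_saturated_real
    (hsat : ∀ AD : D, (π.obj AD).IsReal → ∃ (BD : D) (GD : Subgroup (Aut BD)) (fD : BD ⟶ AD),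
      RC.IsRCSubanchor (baseRC π) BD ∧ IsMonoMinimalQuotient GD fD ∧ GaloisSaturated π fD GD) :
    Literature.AlgebraicGeometry.Frobenioids.ArchFrd.Prop35iii_N π := by
  intro hRC
  refine prop35iii_N_of_saturated π fun AD => ?_
  rcases D0.isReal_or_isComplex (π.obj AD) with h | h
  · exact hsat AD h
  · obtain ⟨BD, GD, fD, hB, hq⟩ := hRC.isRCIsoSubanchor AD
    exact ⟨BD, GD, fD, hB, hq, galoisSaturated_of_isComplex π fD GD h⟩

/-- **[FrdII] Prop. 3.5 (iii) for `N`, AS TYPED, over every base functor with complex image** (no real object,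
so no saturation condition at all) — the positive complement of `ArchFrd.not_prop35iii_N_collapse`, whose base
`D₀ → D₀` has the real object `Spec ℝ`. [cite: MochizukiFrdII2008, Prop 3.5 (iii) p.34] -/
theorem prop35iii_N_of_forall_isComplex (hC : ∀ X : D, (π.obj X).IsComplex) :
    Literature.AlgebraicGeometry.Frobenioids.ArchFrd.Prop35iii_N π :=
  prop35iii_N_of_saturated_real π fun AD h => by
    have hc : π.obj AD = D0.complex := hC AD
    have hr : π.obj AD = D0.real := h
    exact absurd (hr.symm.trans hc) (by rintro ⟨⟩)

end General

/-! ### At the one-morphism base `Spec ℂ` of [IUTchI] Example 3.4 (i) -/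

/-- **Prop. 3.5 (iii) for `N_v`, AS TYPED** (instance `Prop35iii_N`, false for a general base) at the base of
[IUTchI] Ex. 3.4 (i): holds — the base has complex image. [cite: MochizukiFrdII2008, Prop 3.5 (iii) p.34] -/
theorem prop35iii_N_ptBase : Literature.AlgebraicGeometry.Frobenioids.ArchFrd.Prop35iii_N ptBase :=
  prop35iii_N_of_forall_isComplex ptBase fun _ => rfl

/-- **`N_v` is of RC-iso-subanchor type** (w.r.t. `N → C → D → D₀`), unconditionally — the repaired
Prop. 3.5 (iii) for `N` is hypothesis-free at the IUT archimedean base. [cite: MochizukiFrdII2008, Prop 3.5 (iii) p.34] -/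
theorem N.isOfRCIsoSubanchorType_ptBase :
    RC.IsOfRCIsoSubanchorType (N.toC ptBase ⋙ PreFrobenioid.baseFunctor (C.toElem ptBase) ⋙ baseRC ptBase) :=
  prop35iii_N_ptBase ptBase_isOfRCIsoSubanchorType

/-! ### At the RC-standard two-object base `T → D₀` (where Prop. 3.5 (i) fails as typed) -/

namespace P35iToy

open T

/-- In `T`, the quotient arrow `b → a` is a categorical quotient of `b` by the FULL group `Aut(b)` ([FrdI] §0):
every arrow out of `b` fixed by `Aut(b) ∋ σ` is `b → a` itself. [cite: MochizukiFrdI2008, §0 p.18] -/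
theorem T.isCategoricalQuotient_fHom_top : IsCategoricalQuotient (⊤ : Subgroup (Aut Literature.AlgebraicGeometry.Frobenioids.ArchFrd.P35iToy.T.b)) Literature.AlgebraicGeometry.Frobenioids.ArchFrd.P35iToy.T.fHom := by
  refine ⟨fun γ _ => Subsingleton.elim _ _, fun X ψ hψ => ?_⟩
  exact isCategoricalQuotient_fHom.2 ψ fun γ _ => hψ γ (Subgroup.mem_top γ)

/-- In `T`, `b → a` is a MONO-MINIMAL categorical quotient of `b` by the full group `Aut(b)` (a monomorphism
out of `b` through which it factors is an automorphism of `b`: `b → a` itself is not mono).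
[cite: MochizukiFrdI2008, §0 p.18] -/
theorem T.isMonoMinimalQuotient_fHom_top : IsMonoMinimalQuotient (⊤ : Subgroup (Aut Literature.AlgebraicGeometry.Frobenioids.ArchFrd.P35iToy.T.b)) Literature.AlgebraicGeometry.Frobenioids.ArchFrd.P35iToy.T.fHom := by
  refine ⟨T.isCategoricalQuotient_fHom_top, fun A' ζ φ' _ hmono _ => ?_⟩
  cases A'
  · obtain ⟨s, t, rfl⟩ := hom_bb_eq ζ
    exact ⟨⟨au s t, (autoIso s t).hom_inv_id, (autoIso s t).inv_hom_id⟩⟩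
  · exfalso
    have hζ : ζ = Literature.AlgebraicGeometry.Frobenioids.ArchFrd.P35iToy.T.fHom := Subsingleton.elim _ _
    subst hζ
    exact not_mono_fHom hmono

/-- The presentation `(b → a, Aut(b))` is Galois-saturated for `π = toD0`: `τ ∈ Aut(b)` maps to complex
conjugation. [cite: MochizukiFrdII2008, Prop 3.5 (i) p.34] -/
theorem galoisSaturated_fHom_top : GaloisSaturated Literature.AlgebraicGeometry.Frobenioids.ArchFrd.P35iToy.toD0 Literature.AlgebraicGeometry.Frobenioids.ArchFrd.P35iToy.T.fHom (⊤ : Subgroup (Aut Literature.AlgebraicGeometry.Frobenioids.ArchFrd.P35iToy.T.b)) := by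
  intro σ' _
  rcases D0.hom_complex_complex_eq σ' with h | h
  · exact ⟨1, Subgroup.mem_top _, by rw [h]; rfl⟩
  · exact ⟨tau, Subgroup.mem_top _, by rw [h]; rfl⟩

/-- The typed presentation `(b → a, G_D = {1, σ})` of abc-iut-w5-d013 is NOT Galois-saturated for `π = toD0`
(`π` kills `G_D`) — the locus of the failure of Prop. 3.5 (i) as typed (`prop35i_C_iff_saturated`).
[cite: MochizukiFrdII2008, Prop 3.5 (i) p.34] -/
theorem not_galoisSaturated_fHom_GD : ¬ GaloisSaturated Literature.AlgebraicGeometry.Frobenioids.ArchFrd.P35iToy.toD0 Literature.AlgebraicGeometry.Frobenioids.ArchFrd.P35iToy.T.fHom Literature.AlgebraicGeometry.Frobenioids.ArchFrd.P35iToy.T.GD := by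
  intro h
  obtain ⟨g, hg, hgc⟩ := h D0.conj rfl
  obtain ⟨s, t, hst⟩ := hom_bb_eq g.hom
  have ht : t = false := by
    have := (mem_GD_iff g).1 hg
    rwa [hst, tauBit_au] at this
  subst ht
  rw [hst, toD0_map_au] at hgc
  change D0.Hom.gal false = D0.Hom.gal true at hgc
  cases hgc

/-- **[FrdII] Prop. 3.5 (iii) for `N`, AS TYPED, HOLDS at the RC-standard base `T → D₀`** (at which Prop. 3.5 (i)
fails as typed): its one real object `a` has the saturated presentation `(b → a, Aut(b))`.
[cite: MochizukiFrdII2008, Prop 3.5 (iii) p.34] -/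
theorem prop35iii_N_toD0 : Literature.AlgebraicGeometry.Frobenioids.ArchFrd.Prop35iii_N Literature.AlgebraicGeometry.Frobenioids.ArchFrd.P35iToy.toD0 :=
  prop35iii_N_of_saturated_real Literature.AlgebraicGeometry.Frobenioids.ArchFrd.P35iToy.toD0 fun AD hA => by
    cases AD
    · exact absurd (hA : D0.complex = D0.real) (by rintro ⟨⟩)
    · exact ⟨b, ⊤, Literature.AlgebraicGeometry.Frobenioids.ArchFrd.P35iToy.T.fHom, isRCSubanchor_b, T.isMonoMinimalQuotient_fHom_top, galoisSaturated_fHom_top⟩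

/-- **`N` over the RC-standard base `T → D₀` IS of RC-iso-subanchor type** (unconditionally).
[cite: MochizukiFrdII2008, Prop 3.5 (iii) p.34] -/
theorem isOfRCIsoSubanchorType_N_toD0 :
    RC.IsOfRCIsoSubanchorType (N.toC Literature.AlgebraicGeometry.Frobenioids.ArchFrd.P35iToy.toD0 ⋙ PreFrobenioid.baseFunctor (C.toElem Literature.AlgebraicGeometry.Frobenioids.ArchFrd.P35iToy.toD0) ⋙ baseRC Literature.AlgebraicGeometry.Frobenioids.ArchFrd.P35iToy.toD0) :=
  prop35iii_N_toD0 isOfRCIsoSubanchorType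

/-- **At the RC-standard base `T → D₀` the typed Prop. 3.5 (iii) for `N` holds while the typed Prop. 3.5 (i) for
`N` fails** (abc-iut-w5-d013's `not_prop35i_C` transported by abc-iut-w4-d100's `prop35i_N_iff_C`): the printed
route to (iii) through (i) is unavailable there, the printed statement (iii) nonetheless true.
[cite: MochizukiFrdII2008, Prop 3.5 (iii) p.34] -/
theorem prop35iii_N_and_not_prop35i_N_toD0 :
    Literature.AlgebraicGeometry.Frobenioids.ArchFrd.Prop35iii_N Literature.AlgebraicGeometry.Frobenioids.ArchFrd.P35iToy.toD0 ∧
      ¬ Literature.AlgebraicGeometry.Frobenioids.ArchFrd.Prop35i_N Literature.AlgebraicGeometry.Frobenioids.ArchFrd.P35iToy.toD0 :=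
  ⟨prop35iii_N_toD0, fun h => not_prop35i_C ((prop35i_N_iff_C Literature.AlgebraicGeometry.Frobenioids.ArchFrd.P35iToy.toD0).1 h)⟩

end P35iToy

end ArchFrd

end

end Literature.AlgebraicGeometry.Frobenioids
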